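import Summits.ValiantsHypothesis.ValiantsHypothesis.Theorems.DepthWindowPathCost

/-!
# Route `DepthWindow` — `ULPB₂` reduced to one CARRIER ROUND (path-bias builder: iteration, budgets, potential)

Cone-free file (decomp-valiant lens 4, g16; steps P3′–P5 of the `ULPB₂` plan, NODE-v16 §4b/§5.2) supporting the
crux item `HomImmHardTwoOne` (stmt-ValiantsHypothesis-30635).  It does for the PATH-bias conjecture
`UniversalLowTreeBiasAt 2` what `DepthWindowULBReduction.lean` did for `ULB₂`: the whole iteration — per-leaf
budgets, the carrier POTENTIAL `|S_C − Σ w|`, the decaying extraction masses `M_j = 32h/2^j`, the doubly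
exponential scale recursion and the round count — is proved here from a named two-level round statement
`CarrierRound h` (typed below, the g17 target), so that `CarrierRound h` for all `h ≥ 1` gives
`LowPathTreesAt 2 402 3`, hence `UniversalLowTreeBiasAt 2` (the schedule arithmetic and the final reduction
`universalLowTreeBiasAt_two_of_carrierRound` are in the sequel `DepthWindowULPBSchedule.lean`).

THE BUILDER (NODE-v16 §4b).  State at the start of round `j`: current nodes `x : Fin n → ℤ` at scale `v`
(`v·2^j ≤ h`), one CARRIER node `κ`, the PENDING nodes `P = {i ≠ κ : |x i| > v}` (created by the previous
round), all other nodes small (`|x i| ≤ v`); invariant (I2) `Σ_P |x i| + |x κ + Σ_P x − A| ≤ |x κ − A|`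
(`A = Σ x`): merging `P` into the carrier moves its value toward `A` without overshoot.  A round = two levels:
level A merges `{κ} ∪ P` into the new carrier and extracts balanced segments of mass `≤ M_j` from the small
nodes; level B refreshes the rest (the landed `twoLevelRound_core` mechanics, carrier exempt).  Its COST
certificate: the carrier pays `Σ_P |x|`, a pending node pays `≤ |x κ| + Σ_P |x|` and lands in the carrier, a
small node pays `≤ 4(M_j + v)`; the new pending mass is bounded by the new potential (I2 again).  Budgets:
carrier `|x κ − A| + 128h`, everyone else `8(M_j + v_j) + 138h`; they telescope because `2M_{j+1} ≤ M_j` and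
`2v_{j+1} ≤ v_j`.

* `nxtScaleM`, `massAt`, `scaleIter`, `pendSet`, `roundCost`, `budgetAt` — the bookkeeping objects;
* `CarrierRound h` — the round statement (conjecture schema; g17 target, to be proved like `twoLevelRound`);
* `LowPathTree.depth_mono` — padding keeps path costs;
* `lowPathTree_of_carrierRound` — the iteration with budgets and potential (sequel: the schedule
  `v_j·2^j·7^(2^j−1) ≤ h`, the round count and the reduction to `UniversalLowTreeBiasAt 2`).

References: [LimayeSrinivasanTavenas2022] CCC 2022 Question 1, Thm. 3; full version Def. 15, Prop. 16–17,
Lemma 21, Claim 28; [BhargavDuttaSaxena2024] Thm. 3.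
-/

-- layout Summits/ValiantsHypothesis/ValiantsHypothesis forces the duplicated namespace component
set_option linter.dupNamespace false

namespace Summit.ValiantsHypothesis.ValiantsHypothesis.Theorems.DepthWindow.TreeBias

open Finset

variable {d : ℕ}

/-! ### Bookkeeping objects -/

/-- The next scale of a round with extraction mass `M` at scale `v`: segments of `ℓ = ⌊M/v⌋` letters, two prefix
sums within `⌊(2v−1)/ℓ⌋`. [folklore] -/
def nxtScaleM (M v : ℕ) : ℕ := (2 * v - 1) / (M / v)

/-- The extraction mass of round `j`: `M_j = ⌊32h / 2^j⌋` (geometric decay — the summable schedule). [folklore] -/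
def massAt (h j : ℕ) : ℕ := 32 * h / 2 ^ j

/-- The scale after `r` further rounds, starting at round `j` with scale `v`. [folklore] -/
def scaleIter (h : ℕ) : ℕ → ℕ → ℕ → ℕ
  | _, v, 0 => v
  | j, v, r + 1 => scaleIter h (j + 1) (nxtScaleM (massAt h j) v) r

/-- The PENDING nodes: non-carrier nodes of modulus `> v`. [folklore] -/
def pendSet {n : ℕ} (x : Fin n → ℤ) (κ : Fin n) (v : ℕ) : Finset (Fin n) :=
  univ.filter fun i => i ≠ κ ∧ (v : ℤ) < |x i|

/-- The path cost charged to node `a` by a two-level round with groupings `c₁`, `c₂`: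
`(mass(c₁ a) − |x a|) + (mass(c₂ (c₁ a)) − |x¹ (c₁ a)|)`. [cite: LimayeSrinivasanTavenas2022, Prop. 17] -/
def roundCost {n M₁ M₂ : ℕ} (x : Fin n → ℤ) (c₁ : Fin n → Fin M₁) (c₂ : Fin M₁ → Fin M₂) (a : Fin n) : ℤ :=
  ((∑ j ∈ univ.filter (fun j => c₁ j = c₁ a), |x j|) - |x a|) +
    ((∑ m ∈ univ.filter (fun m => c₂ m = c₂ (c₁ a)), |quotWord x c₁ m|) - |quotWord x c₁ (c₁ a)|)

/-- The path budget of a non-carrier node at round `j`, scale `v`: `8(M_j + v) + 138h`. [folklore] -/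
def budgetAt (h j v : ℕ) : ℤ := 8 * ((massAt h j : ℤ) + v) + 138 * h

/-- **The carrier round** (conjecture schema; the g17 target of lens 4, NODE-v16 §4b).  Input: nodes `x` at
scale `v ≥ 1` with extraction mass `M` (`5v ≤ M ≤ 32h`), a carrier `κ`, non-carrier nodes of modulus `≤ 2h`,
`|Σ x| ≤ h`, carrier potential `|x κ − Σ x| ≤ 2h`, and the no-overshoot invariant (I2) for the pending set.
Output: two onto groupings with block masses `≤ 128h` such that the new carrier `κ' = c₂ (c₁ κ)` holds exactly
`x κ + Σ_P x` and contains the pending nodes, the other new nodes have modulus `≤ 2h`, (I2) holds at the new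
scale `nxtScaleM M v`, and the COSTS are certified: carrier `≤ Σ_P |x|`, pending `≤ |x κ| + Σ_P |x|`, small
`≤ 4(M + v)`. [cite: LimayeSrinivasanTavenas2022, Lemma 21, Claim 28, Prop. 17] -/
@[conjecture] def CarrierRound (h : ℕ) : Prop :=
  ∀ (n M v : ℕ) (x : Fin n → ℤ) (κ : Fin n), 1 ≤ v → 5 * v ≤ M → M ≤ 32 * h →
    (∀ i, i ≠ κ → |x i| ≤ 2 * h) → |∑ i, x i| ≤ h → |x κ - ∑ i, x i| ≤ 2 * h →
    (∑ i ∈ pendSet x κ v, |x i|) + |x κ + ∑ i ∈ pendSet x κ v, x i - ∑ i, x i| ≤ |x κ - ∑ i, x i| →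
    ∃ (M₁ : ℕ) (c₁ : Fin n → Fin M₁), Function.Surjective c₁ ∧
      (∀ m, ∑ j ∈ univ.filter (fun j => c₁ j = m), |x j| ≤ 128 * h) ∧
      ∃ (M₂ : ℕ) (c₂ : Fin M₁ → Fin M₂), Function.Surjective c₂ ∧
        (∀ m, ∑ j ∈ univ.filter (fun j => c₂ j = m), |quotWord x c₁ j| ≤ 128 * h) ∧
        quotWord (quotWord x c₁) c₂ (c₂ (c₁ κ)) = x κ + ∑ i ∈ pendSet x κ v, x i ∧
        (∀ a ∈ pendSet x κ v, c₂ (c₁ a) = c₂ (c₁ κ)) ∧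
        (∀ b, b ≠ c₂ (c₁ κ) → |quotWord (quotWord x c₁) c₂ b| ≤ 2 * h) ∧
        ((∑ b ∈ pendSet (quotWord (quotWord x c₁) c₂) (c₂ (c₁ κ)) (nxtScaleM M v),
            |quotWord (quotWord x c₁) c₂ b|) +
          |quotWord (quotWord x c₁) c₂ (c₂ (c₁ κ)) +
              ∑ b ∈ pendSet (quotWord (quotWord x c₁) c₂) (c₂ (c₁ κ)) (nxtScaleM M v),
                quotWord (quotWord x c₁) c₂ b - ∑ i, x i| ≤
          |quotWord (quotWord x c₁) c₂ (c₂ (c₁ κ)) - ∑ i, x i|) ∧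
        roundCost x c₁ c₂ κ ≤ ∑ i ∈ pendSet x κ v, |x i| ∧
        (∀ a ∈ pendSet x κ v, roundCost x c₁ c₂ a ≤ |x κ| + ∑ i ∈ pendSet x κ v, |x i|) ∧
        (∀ a, a ≠ κ → a ∉ pendSet x κ v → roundCost x c₁ c₂ a ≤ 4 * ((M : ℤ) + v))

/-! ### Scale arithmetic -/

/-- With `5v ≤ M` the next scale is at most half the scale. [folklore] -/
theorem two_mul_nxtScaleM_le {M v : ℕ} (hv : 1 ≤ v) (h5 : 5 * v ≤ M) : 2 * nxtScaleM M v ≤ v := by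
  unfold nxtScaleM
  have hq : 5 ≤ M / v := by rw [Nat.le_div_iff_mul_le (by omega)]; exact h5
  calc 2 * ((2 * v - 1) / (M / v)) ≤ 2 * ((2 * v - 1) / 5) :=
        Nat.mul_le_mul_left _ (Nat.div_le_div_left hq (by norm_num))
    _ ≤ v := by omega

/-- At scale `0` the next scale is `0`. [folklore] -/
theorem nxtScaleM_zero (M : ℕ) : nxtScaleM M 0 = 0 := by simp [nxtScaleM]

/-- **One round squares the relative scale**: `(M − v)·v' ≤ 2v²`. [folklore] -/
theorem nxtScaleM_bound (M v : ℕ) (hv : v ≤ M) : (M - v) * nxtScaleM M v ≤ 2 * v * v := by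
  unfold nxtScaleM
  rcases Nat.eq_zero_or_pos v with rfl | hv0
  · simp
  · set q := M / v with hq
    have hdm := Nat.div_add_mod M v
    have hml := Nat.mod_lt M hv0
    rw [← hq] at hdm
    have hqv : M - v ≤ v * q := by
      have : M < v * q + v := by omega
      omega
    have hnd := Nat.div_mul_le_self (2 * v - 1) q
    calc (M - v) * ((2 * v - 1) / q) ≤ v * q * ((2 * v - 1) / q) := Nat.mul_le_mul_right _ hqv
      _ = v * ((2 * v - 1) / q * q) := by ring
      _ ≤ v * (2 * v - 1) := Nat.mul_le_mul_left _ hnd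
      _ ≤ 2 * v * v := by
          have : 2 * v - 1 ≤ 2 * v := Nat.sub_le _ _
          nlinarith

/-- The masses halve: `M_{j+1} = ⌊M_j / 2⌋`. [folklore] -/
theorem massAt_succ (h j : ℕ) : massAt h (j + 1) = massAt h j / 2 := by
  unfold massAt
  rw [pow_succ, ← Nat.div_div_eq_div_mul]

/-- `M_j ≤ 32h`. [folklore] -/
theorem massAt_le (h j : ℕ) : massAt h j ≤ 32 * h := Nat.div_le_self _ _

/-- `2^j · M_j ≥ 32h − 2^j + 1`. [folklore] -/
theorem pow_mul_massAt_ge (h j : ℕ) : 32 * h < 2 ^ j * massAt h j + 2 ^ j := by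
  unfold massAt
  have := Nat.lt_div_mul_add (a := 32 * h) (b := 2 ^ j) (by positivity)
  linarith [Nat.mul_comm (32 * h / 2 ^ j) (2 ^ j)]

/-- The scale regime from the invariant `v·2^j ≤ h`: `5v ≤ M_j`. [folklore] -/
theorem five_mul_le_massAt {h j v : ℕ} (hv : v * 2 ^ j ≤ h) : 5 * v ≤ massAt h j := by
  unfold massAt
  rw [Nat.le_div_iff_mul_le (by positivity)]
  nlinarith

/-- Unfolding the scale iteration by one round. [folklore] -/
theorem scaleIter_succ (h j v r : ℕ) :
    scaleIter h j v (r + 1) = scaleIter h (j + 1) (nxtScaleM (massAt h j) v) r := rfl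

/-! ### Padding keeps path costs -/

/-- Below the freezing level the sibling costs of the padded tree are those of the tree. [folklore] -/
theorem sibCost_pad_of_le (w : Fin d → ℤ) (T : LTree d) {Δ u : ℕ} (hu : u ≤ Δ) (i : Fin d) :
    sibCost w (T.pad Δ) u i = sibCost w T u i := by
  unfold sibCost
  rw [nodeBias_pad_of_le w T hu, T.pad_lab_of_le (by omega : u - 1 ≤ Δ),
    blockSum_pad_of_le w T (by omega : u - 1 ≤ Δ)]

/-- Above a single-block level the padded tree is unary: sibling cost `0`. [folklore] -/
theorem sibCost_pad_of_gt (w : Fin d → ℤ) (T : LTree d) {Δ u : ℕ} (hroot : ∀ i j, T.lab Δ i = T.lab Δ j)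
    (hu : Δ < u) (i : Fin d) : sibCost w (T.pad Δ) u i = 0 := by
  unfold sibCost
  rw [nodeBias_pad_of_gt w T hroot hu, T.pad_lab_of_ge (by omega : Δ ≤ u - 1)]
  have hb : blockSum w (T.pad Δ) (u - 1) (T.lab Δ i) = ∑ j, w j := by
    unfold blockSum
    rw [T.pad_lab_of_ge (by omega : Δ ≤ u - 1), filter_true_of_mem fun j _ => hroot j i]
  rw [hb, sub_self]

/-- Padding from a single-block level `Δ` does not change the path costs. [folklore] -/
theorem pathCost_pad (w : Fin d → ℤ) (T : LTree d) {Δ : ℕ} (hroot : ∀ i j, T.lab Δ i = T.lab Δ j) :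
    ∀ {Δ' : ℕ}, Δ ≤ Δ' → ∀ i, pathCost w (T.pad Δ) Δ' i = pathCost w T Δ i := by
  intro Δ' hle
  induction Δ', hle using Nat.le_induction with
  | base =>
    intro i
    unfold pathCost
    exact sum_congr rfl fun u hu => sibCost_pad_of_le w T (mem_Icc.1 hu).2 i
  | succ Δ' hle ih =>
    intro i
    rw [pathCost_succ, ih i, sibCost_pad_of_gt w T hroot (by omega) i, add_zero]

/-- **Padding** for low-path trees: depth `Δ' ≥ Δ` with the same budgets, provided `|Σ w| ≤ β` (the node bias
of the unary nodes above the old root). [cite: LimayeSrinivasanTavenas2022, Def. 2] -/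
theorem LowPathTree.depth_mono {w : Fin d → ℤ} {Δ Δ' : ℕ} {β : ℤ} {γ : Fin d → ℤ} (hT : LowPathTree w Δ β γ)
    (hle : Δ ≤ Δ') (hsum : |∑ j, w j| ≤ β) : LowPathTree w Δ' β γ := by
  obtain ⟨T, hroot, hnb, hpc⟩ := hT
  refine ⟨T.pad Δ, fun i j => ?_, fun u hu1 hu i => ?_, fun i => ?_⟩
  · rw [T.pad_lab_of_ge hle]; exact hroot i j
  · rcases le_or_gt u Δ with huΔ | huΔ
    · rw [nodeBias_pad_of_le w T huΔ]; exact hnb u hu1 huΔ i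
    · rw [nodeBias_pad_of_gt w T hroot huΔ]; exact hsum
  · rw [pathCost_pad w T hroot hle]; exact hpc i

/-! ### The iteration: budgets and potential -/

/-- Splitting the `ℓ¹`-mass of a carrier state: carrier + pending + `n·v`. [folklore] -/
theorem sum_abs_le_carrier {n : ℕ} (x : Fin n → ℤ) (κ : Fin n) (v : ℕ) :
    ∑ i, |x i| ≤ |x κ| + (∑ i ∈ pendSet x κ v, |x i|) + (n : ℤ) * v := by
  have hpt : ∀ i, |x i| ≤ (if i = κ then |x κ| else 0) + (if i ∈ pendSet x κ v then |x i| else 0) + v := by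
    intro i
    by_cases hi : i = κ
    · subst hi
      have hκP : i ∉ pendSet x i v := by simp [pendSet]
      have hv : (0 : ℤ) ≤ v := by positivity
      simp [hκP]
    · by_cases hp : i ∈ pendSet x κ v
      · simp [hi, hp]
      · have : |x i| ≤ v := by
          simp only [pendSet, mem_filter, mem_univ, true_and, not_and, not_lt] at hp
          exact hp hi
        simp [hi, hp]; linarith [abs_nonneg (x κ)]
  calc ∑ i, |x i| ≤ ∑ i, ((if i = κ then |x κ| else 0) + (if i ∈ pendSet x κ v then |x i| else 0) + (v : ℤ)) :=
        sum_le_sum fun i _ => hpt i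
    _ = |x κ| + (∑ i ∈ pendSet x κ v, |x i|) + (n : ℤ) * v := by
        simp only [sum_add_distrib, sum_ite_eq', mem_univ, if_true, sum_ite_mem, univ_inter,
          sum_const, card_univ, Fintype.card_fin, nsmul_eq_mul]

/-- The final level: a carrier state with `n·v + 5h ≤ 128h` is a depth-one low-path tree (the star) within every
budget `≥ 128h`. [folklore] -/
theorem lowPathTree_one_carrier {n h : ℕ} (x : Fin n → ℤ) (κ : Fin n) (v : ℕ)
    (hsum : |∑ i, x i| ≤ h) (hD : |x κ - ∑ i, x i| ≤ 2 * h)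
    (hI : (∑ i ∈ pendSet x κ v, |x i|) + |x κ + ∑ i ∈ pendSet x κ v, x i - ∑ i, x i| ≤ |x κ - ∑ i, x i|)
    (hcount : (n : ℤ) * v + 5 * h ≤ 128 * h) {γ : Fin n → ℤ} (hγ : ∀ a, (128 * h : ℤ) ≤ γ a) :
    LowPathTree x 1 ((128 * h : ℕ) : ℤ) γ := by
  have hκ : |x κ| ≤ 3 * h := by
    have := abs_sub_abs_le_abs_sub (x κ) (∑ i, x i); linarith
  have hP : (∑ i ∈ pendSet x κ v, |x i|) ≤ 2 * h := by linarith [abs_nonneg (x κ + ∑ i ∈ pendSet x κ v, x i - ∑ i, x i)]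
  have hmass : ∑ i, |x i| ≤ ((128 * h : ℕ) : ℤ) := by
    have := sum_abs_le_carrier x κ v; push_cast; linarith
  refine (lowPathTree_one hmass).mono le_rfl fun a => ?_
  have := hγ a
  have h0 : 0 ≤ |x a| := abs_nonneg _
  push_cast at hmass
  linarith

/-- **The iteration.**  Under `CarrierRound h`: a carrier state at round `j`, scale `v` (`v·2^j ≤ h`) has a
low-path tree of depth `2r + 1`, node biases `≤ 128h`, carrier budget `|x κ − Σ x| + 128h` and non-carrier
budget `budgetAt h j v`, as soon as `n·v_{j+r} + 5h ≤ 128h`. [cite: LimayeSrinivasanTavenas2022, Prop. 17] -/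
theorem lowPathTree_of_carrierRound {h : ℕ} (hh : 1 ≤ h) (hR : CarrierRound h) :
    ∀ (r : ℕ) {n : ℕ} (j v : ℕ) (x : Fin n → ℤ) (κ : Fin n), v * 2 ^ j ≤ h →
      (∀ i, i ≠ κ → |x i| ≤ 2 * h) → |∑ i, x i| ≤ h → |x κ - ∑ i, x i| ≤ 2 * h →
      (∑ i ∈ pendSet x κ v, |x i|) + |x κ + ∑ i ∈ pendSet x κ v, x i - ∑ i, x i| ≤ |x κ - ∑ i, x i| →
      (n : ℤ) * (scaleIter h j v r : ℕ) + 5 * h ≤ 128 * h →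
      LowPathTree x (2 * r + 1) ((128 * h : ℕ) : ℤ)
        (fun a => if a = κ then |x κ - ∑ i, x i| + 128 * h else budgetAt h j v) := by
  intro r
  induction r with
  | zero =>
    intro n j v x κ hvj hx hsum hD hI hcount
    refine lowPathTree_one_carrier x κ v hsum hD hI (by simpa [scaleIter] using hcount) fun a => ?_
    by_cases ha : a = κ
    · rw [if_pos ha]; linarith [abs_nonneg (x κ - ∑ i, x i)]
    · rw [if_neg ha]; unfold budgetAt
      have h1 : (0 : ℤ) ≤ (massAt h j : ℤ) := by positivity
      have h2 : (0 : ℤ) ≤ (v : ℤ) := by positivity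
      linarith
  | succ r ih =>
    intro n j v x κ hvj hx hsum hD hI hcount
    have hbudget_ge : ∀ j' v' : ℕ, (138 * h : ℤ) ≤ budgetAt h j' v' := fun j' v' => by
      unfold budgetAt
      have h1 : (0 : ℤ) ≤ (massAt h j' : ℤ) := by positivity
      have h2 : (0 : ℤ) ≤ (v' : ℤ) := by positivity
      linarith
    rcases Nat.eq_zero_or_pos v with rfl | hv1
    · -- scale 0: every non-carrier non-pending node is 0; finish with the star now and pad
      have hT1 : LowPathTree x 1 ((128 * h : ℕ) : ℤ)
          (fun a => if a = κ then |x κ - ∑ i, x i| + 128 * h else budgetAt h j 0) := by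
        refine lowPathTree_one_carrier x κ 0 hsum hD hI (by push_cast; linarith) fun a => ?_
        by_cases ha : a = κ
        · rw [if_pos ha]; linarith [abs_nonneg (x κ - ∑ i, x i)]
        · rw [if_neg ha]; linarith [hbudget_ge j 0]
      exact hT1.depth_mono (by omega) (by push_cast; linarith)
    · have h5 : 5 * v ≤ massAt h j := five_mul_le_massAt hvj
      obtain ⟨M₁, c₁, hc₁, hm₁, M₂, c₂, hc₂, hm₂, hyκ, hmem, hyb, hI', hcκ, hcP, hcS⟩ :=
        hR n (massAt h j) v x κ hv1 h5 (massAt_le h j) hx hsum hD hI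
      rw [scaleIter_succ] at hcount
      set y := quotWord (quotWord x c₁) c₂ with hy
      set κ' := c₂ (c₁ κ) with hκ'
      set e := nxtScaleM (massAt h j) v with he
      have hysum : ∑ m, y m = ∑ i, x i := by rw [hy, sum_quotWord, sum_quotWord]
      have hM₁ : M₁ ≤ n := by simpa using Fintype.card_le_of_surjective c₁ hc₁
      have hM₂ : M₂ ≤ M₁ := by simpa using Fintype.card_le_of_surjective c₂ hc₂
      have h2e : 2 * e ≤ v := two_mul_nxtScaleM_le hv1 h5
      have hej : e * 2 ^ (j + 1) ≤ h := by
        rw [pow_succ]; nlinarith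
      have hP0 : 0 ≤ ∑ i ∈ pendSet x κ v, |x i| := sum_nonneg fun _ _ => abs_nonneg _
      have hD' : |y κ' - ∑ m, y m| ≤ 2 * h := by
        rw [hysum, hyκ]; linarith
      have hI'' : (∑ b ∈ pendSet y κ' e, |y b|) + |y κ' + ∑ b ∈ pendSet y κ' e, y b - ∑ m, y m| ≤
          |y κ' - ∑ m, y m| := by rw [hysum]; exact hI'
      have hcount' : (M₂ : ℤ) * (scaleIter h (j + 1) e r : ℕ) + 5 * h ≤ 128 * h := by
        have : (M₂ : ℤ) ≤ n := by exact_mod_cast hM₂.trans hM₁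
        have h0 : (0 : ℤ) ≤ (scaleIter h (j + 1) e r : ℕ) := by positivity
        nlinarith
      -- the quotient tree, with budgets
      have hT : LowPathTree y (2 * r + 1) ((128 * h : ℕ) : ℤ)
          (fun b => if b = κ' then |y κ' - ∑ m, y m| + 128 * h else budgetAt h (j + 1) e) :=
        ih (j + 1) e y κ' hej hyb (hysum ▸ hsum) hD' hI'' hcount'
      -- level B (grouping c₂) with the exact intermediate budgets
      have hm₂' : ∀ m, ∑ j ∈ univ.filter (fun j => c₂ j = m), |quotWord x c₁ j| ≤ ((128 * h : ℕ) : ℤ) :=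
        fun m => by push_cast; exact hm₂ m
      have hm₁' : ∀ m, ∑ j ∈ univ.filter (fun j => c₁ j = m), |x j| ≤ ((128 * h : ℕ) : ℤ) :=
        fun m => by push_cast; exact hm₁ m
      have hT₁ : LowPathTree (quotWord x c₁) (2 * r + 1 + 1) ((128 * h : ℕ) : ℤ)
          (fun m => ((∑ m' ∈ univ.filter (fun m' => c₂ m' = c₂ m), |quotWord x c₁ m'|) -
            |quotWord x c₁ m|) +
            (if c₂ m = κ' then |y κ' - ∑ m, y m| + 128 * h else budgetAt h (j + 1) e)) :=
        lowPathTree_succ_of_quotient c₂ hc₂ hm₂' (fun m => le_rfl) hT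
      -- level A (grouping c₁): the budget inequality for every node `a` (three cost classes)
      have hκ3 : |x κ| ≤ 3 * h := by
        have := abs_sub_abs_le_abs_sub (x κ) (∑ i, x i); linarith
      have hyD : |y κ' - ∑ m, y m| ≤ |x κ - ∑ i, x i| - ∑ i ∈ pendSet x κ v, |x i| := by
        rw [hysum, hyκ]; linarith
      have hγA : ∀ a, (∑ j ∈ univ.filter (fun j => c₁ j = c₁ a), |x j|) - |x a| +
          (fun m => ((∑ m' ∈ univ.filter (fun m' => c₂ m' = c₂ m), |quotWord x c₁ m'|) -
            |quotWord x c₁ m|) +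
            (if c₂ m = κ' then |y κ' - ∑ m, y m| + 128 * h else budgetAt h (j + 1) e)) (c₁ a) ≤
          (fun a => if a = κ then |x κ - ∑ i, x i| + 128 * h else budgetAt h j v) a := by
        intro a
        beta_reduce
        have hstep : roundCost x c₁ c₂ a =
            ((∑ j ∈ univ.filter (fun j => c₁ j = c₁ a), |x j|) - |x a|) +
              ((∑ m' ∈ univ.filter (fun m' => c₂ m' = c₂ (c₁ a)), |quotWord x c₁ m'|) -
                |quotWord x c₁ (c₁ a)|) := rfl
        by_cases haκ : a = κ
        · have hin : c₂ (c₁ a) = κ' := by rw [haκ]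
          rw [if_pos haκ, if_pos hin]
          have hc : roundCost x c₁ c₂ a ≤ ∑ i ∈ pendSet x κ v, |x i| := by rw [haκ]; exact hcκ
          linarith
        · rw [if_neg haκ]
          by_cases haP : a ∈ pendSet x κ v
          · rw [if_pos (hmem a haP)]
            have hc := hcP a haP
            have hb := hbudget_ge j v
            unfold budgetAt at hb ⊢
            linarith
          · have hsmall := hcS a haκ haP
            have hnext : (if c₂ (c₁ a) = κ' then |y κ' - ∑ m, y m| + 128 * h else budgetAt h (j + 1) e) ≤
                budgetAt h (j + 1) e := by
              split_ifs
              · linarith [hbudget_ge (j + 1) e]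
              · exact le_rfl
            have htel : 4 * ((massAt h j : ℤ) + v) + budgetAt h (j + 1) e ≤ budgetAt h j v := by
              unfold budgetAt
              have hM : 2 * massAt h (j + 1) ≤ massAt h j := by rw [massAt_succ]; omega
              have hM' : (2 : ℤ) * (massAt h (j + 1) : ℕ) ≤ (massAt h j : ℕ) := by exact_mod_cast hM
              have h2e' : (2 : ℤ) * (e : ℕ) ≤ (v : ℕ) := by exact_mod_cast h2e
              linarith
            linarith
      have hT₀ := lowPathTree_succ_of_quotient c₁ hc₁ hm₁' hγA hT₁
      simpa [show 2 * (r + 1) + 1 = 2 * r + 1 + 1 + 1 by ring] using hT₀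

end Summit.ValiantsHypothesis.ValiantsHypothesis.Theorems.DepthWindow.TreeBias
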